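import Mathlib
import Summits.ResolutionOfSingularities.ResolutionOfSingularities.Theorems.CleanModels.Negative.CossartPiltant2019Thm15iFrameFalseOfOrdTowerShape
import HarnessLib

/-!
# Towards `OrdTowerShape 5`: the trivial step, the valuation-ring step, and the kind-`O` shape facts

Support lemmas (INPUTS seat res-inputs-p-cp15frame g1, 2026-08-28) for discharging the residual hypothesis
`OrdTowerShape 5` of `CossartPiltant2019_thm_1_5_i_frame_false_of_ordTowerShape`
(`CossartPiltant2019Thm15iFrameFalseOfOrdTowerShape.lean`; crux `CleanModels`, stmt-ResolutionOfSingularities-15917; ROADMAP in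
`run/shared/lean/pub/res-hironaka/plan/inputs/p-cp15frame/HANDOFF.md` § g1).  res-inputs-crit-1 R190 (3) classifies the members of
an F-110 tower along `O = ord_𝔪` on `𝔽₅[x,y,w]_{(x,y,w)}` into three kinds — `S` itself, the curve blow-ups `B♯`, and `O` — by an
induction over `IsLocalBlowupAlong` steps.  This file proves the GENERIC pieces of that induction (any field `L`, any valuation
ring `W`) and the facts about the kinds `S` (start) and `O` (end):

* `locAtCentre_eq_self_of_isUnit` / `OrdWitness.locAtCentre_range_eq` — roadmap T0: the tower starts at `B 0 = S` (the image of
  `S` in `K` is local and dominated, so localising at the centre does nothing);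
* `eq_of_isLocalBlowupAlong_of_span_singleton` — roadmap T1, the TRIVIAL STEP: a local blowing up of a dominated local ring along a
  PRINCIPAL centre `(π)` changes nothing (`u₀ = unit · π`, every `x/u₀ ∈ B`);
* `eq_of_isLocalBlowupAlong_valuationSubring` — roadmap III→III: a local blowing up of the valuation ring itself is the
  valuation ring;
* `OrdWitness.ordVK_eq_expNeg_one_of_kindO`, `OrdWitness.exists_pow_of_kindO` — roadmap T5-III: the two `OrdTowerShape` clauses
  for a member equal to `O` (a regular parameter of the DVR `ord_𝔪` has order exactly `1`, by discreteness and `ord X₀ = 1`;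
  residues need no descent).

Not here (roadmap T2–T4, T5-I/II): principal-ness of height-one regular centres, the passage `S → B♯ → O`, and the `B♯` shape
facts — the remaining work for an unconditional `¬ F-110`.  Nothing here proves or refutes resolution of singularities in
characteristic `p`; [OURS · NEGATIVE-SUPPORT] counted 0.
-/

noncomputable section

set_option linter.dupNamespace false -- mandated namespace of this single-conjunct summit

open MvPolynomial IsLocalRing
open Literature.AlgebraicGeometry.Resolution

namespace Summit.ResolutionOfSingularities.ResolutionOfSingularities.Theorems.CleanModels.Negative

/-! ## 1. Generic steps (any field, any valuation ring) -/

/-- A unit of a subring `B ⊆ W` has `W`-value `1`. [folklore] -/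
theorem valuation_eq_one_of_isUnit {L : Type} [Field L] {W : ValuationSubring L} {B : Subring L}
    (hBW : B ≤ W.toSubring) {b : B} (hb : IsUnit b) : W.valuation (b : L) = 1 := by
  obtain ⟨u, rfl⟩ := hb
  have h1 : W.valuation ((u : B) : L) * W.valuation ((↑u⁻¹ : B) : L) = 1 := by
    rw [← map_mul, ← Subring.coe_mul, Units.mul_inv, Subring.coe_one, map_one]
  have ha : W.valuation ((u : B) : L) ≤ 1 := (W.valuation_le_one_iff _).mpr (hBW (u : B).2)
  have hb' : W.valuation ((↑u⁻¹ : B) : L) ≤ 1 := (W.valuation_le_one_iff _).mpr (hBW (↑u⁻¹ : B).2)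
  refine le_antisymm ha ?_
  by_contra hlt
  have : W.valuation ((u : B) : L) * W.valuation ((↑u⁻¹ : B) : L) < 1 * 1 :=
    mul_lt_mul_of_lt_of_le_of_nonneg_of_pos (not_le.mp hlt) hb' zero_le zero_lt_one
  rw [h1, one_mul] at this
  exact lt_irrefl _ this

/-- **Roadmap T0 (generic form).**  If every element of `B ⊆ W` of value `1` is a unit of `B` (i.e. `B` is local and dominated by
`W`), then localising `B` at the centre of `W` changes nothing. [folklore] -/
theorem locAtCentre_eq_self_of_isUnit {L : Type} [Field L] {W : ValuationSubring L} {B : Subring L}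
    (h : ∀ b : B, W.valuation (b : L) = 1 → IsUnit b) : locAtCentre B W = B := by
  refine le_antisymm ?_ (le_locAtCentre B W)
  rintro _ ⟨y, hy, z, hz, hv, rfl⟩
  obtain ⟨u, hu⟩ := h ⟨z, hz⟩ hv
  have hmul1 : ((↑u⁻¹ : B) : L) * (z : L) = 1 := by
    have := congr_arg (fun t : B => (t : L)) u.inv_mul
    simpa [hu] using this
  have hzinv : (z : L)⁻¹ ∈ B := by
    rw [inv_eq_of_mul_eq_one_left hmul1]
    exact (↑u⁻¹ : B).2
  rw [div_eq_mul_inv]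
  exact B.mul_mem hy hzinv

/-- **Roadmap III→III: a local blowing up of the valuation ring is the valuation ring.** [folklore] -/
theorem eq_of_isLocalBlowupAlong_valuationSubring {L : Type} [Field L] {W : ValuationSubring L}
    {P : Ideal W.toSubring} {B' : Subring L} (H : IsLocalBlowupAlong W W.toSubring P B') : B' = W.toSubring := by
  obtain ⟨-, t, ht, rfl⟩ := H.isLocalBlowup
  have hcl : Subring.closure ((W.toSubring : Set L) ∪ ↑t) = W.toSubring :=
    le_antisymm (Subring.closure_le.mpr (Set.union_subset (fun _ h => h) ht))
      (fun x hx => Subring.subset_closure (Or.inl hx))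
  rw [hcl]
  exact le_antisymm (locAtCentre_le le_rfl) (le_locAtCentre _ W)

/-- **Roadmap T1, the TRIVIAL STEP: blowing up a principal centre changes nothing.**  Let `B ⊆ W` be a local subring which is
its own localisation at the centre of `W` (every member of a tower of local blowing ups is), and `P = (π)` a principal ideal of
`B`.  If `B'` is a local blowing up of `B` along `P` with respect to `W`, then `B' = B`: the chart generator `u₀ = b₀π` of minimal
value has `b₀` a unit (some generator `bπ` has `b` a unit, by Nakayama in the form `π ∉ 𝔪π`), so every `x/u₀` already lies in
`B`. [folklore] -/
theorem eq_of_isLocalBlowupAlong_of_span_singleton {L : Type} [Field L] {W : ValuationSubring L} {B B' : Subring L}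
    [IsLocalRing B] (hfix : locAtCentre B W = B) {P : Ideal B} {π : B} (hP : P = Ideal.span {π})
    (H : IsLocalBlowupAlong W B P B') : B' = B := by
  classical
  obtain ⟨hBW, u, u₀, hspan, hu₀, hne, hval, rfl⟩ := H
  have hdom : ∀ x : B, x ∈ maximalIdeal B ↔ W.valuation (x : L) < 1 :=
    OrdWitness.mem_maximalIdeal_iff_valuation_lt_one hBW hfix
  -- every generator is a multiple of `π`
  have hmul : ∀ x ∈ u, ∃ b : B, b * π = x := fun x hx =>
    Ideal.mem_span_singleton'.mp (hP ▸ hspan ▸ Ideal.subset_span hx)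
  -- `π ≠ 0`
  have hπ0 : π ≠ 0 := by
    rintro rfl
    obtain ⟨b, hb⟩ := hmul u₀ hu₀
    rw [mul_zero] at hb
    exact hne hb.symm
  -- some generator is `unit · π`
  have key : ∃ x ∈ u, ∃ b : B, b * π = x ∧ IsUnit b := by
    by_contra hcon
    push Not at hcon
    have hle : Ideal.span (↑u : Set B) ≤ maximalIdeal B * Ideal.span {π} := by
      refine Ideal.span_le.mpr fun x hx => ?_
      obtain ⟨b, hb⟩ := hmul x hx
      have hbm : b ∈ maximalIdeal B := (IsLocalRing.mem_maximalIdeal _).mpr (hcon x hx b hb)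
      rw [← hb]
      exact Ideal.mul_mem_mul hbm (Ideal.mem_span_singleton_self π)
    have hπmem : π ∈ maximalIdeal B * Ideal.span {π} :=
      hle (hspan ▸ hP ▸ Ideal.mem_span_singleton_self π)
    obtain ⟨z, hz, hzπ⟩ := Ideal.mem_mul_span_singleton.mp hπmem
    have h1 : (1 - z) * π = 0 := by rw [sub_mul, one_mul, hzπ, sub_self]
    have hunit : IsUnit (1 - z) := IsLocalRing.isUnit_one_sub_self_of_mem_nonunits z hz
    exact hπ0 ((hunit.mul_right_eq_zero).mp h1)
  obtain ⟨x₁, hx₁, b₁, hb₁, hb₁u⟩ := key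
  obtain ⟨b₀, hb₀⟩ := hmul u₀ hu₀
  -- values: `val u₀ = val b₀ · val π ≥ val x₁ = val π`, so `val b₀ = 1` and `b₀` is a unit
  have hvπ0 : W.valuation (π : L) ≠ 0 := by
    rw [ne_eq, map_eq_zero]
    exact fun e => hπ0 (Subtype.ext e)
  have hvx₁ : W.valuation (x₁ : L) = W.valuation (π : L) := by
    rw [← hb₁, Subring.coe_mul, map_mul, valuation_eq_one_of_isUnit hBW hb₁u, one_mul]
  have hb₀v : W.valuation (b₀ : L) = 1 := by
    have h1 : W.valuation (b₀ : L) ≤ 1 := (W.valuation_le_one_iff _).mpr (hBW b₀.2)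
    have h2 : W.valuation (x₁ : L) ≤ W.valuation (u₀ : L) := hval x₁ hx₁
    rw [hvx₁, ← hb₀, Subring.coe_mul, map_mul] at h2
    refine le_antisymm h1 ?_
    by_contra hlt
    have : W.valuation (b₀ : L) * W.valuation (π : L) < 1 * W.valuation (π : L) :=
      mul_lt_mul_of_pos_right (not_le.mp hlt) (pos_iff_ne_zero.mpr hvπ0)
    rw [one_mul] at this
    exact not_le.mpr this h2
  have hb₀u : IsUnit b₀ := by
    by_contra hnu
    have := (hdom b₀).mp ((IsLocalRing.mem_maximalIdeal _).mpr hnu)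
    rw [hb₀v] at this
    exact lt_irrefl _ this
  obtain ⟨v₀, hv₀⟩ := hb₀u
  -- every `x/u₀` lies in `B`
  have himg : (fun x : B => (x : L) / u₀) '' ↑u ⊆ (B : Set L) := by
    rintro _ ⟨x, hx, rfl⟩
    obtain ⟨b, hb⟩ := hmul x hx
    have hu₀L : ((u₀ : B) : L) = (b₀ : L) * (π : L) := by rw [← hb₀, Subring.coe_mul]
    have hxL : ((x : B) : L) = (b : L) * (π : L) := by rw [← hb, Subring.coe_mul]
    have hb₀0 : ((b₀ : B) : L) ≠ 0 := ne_zero_of_valuation_eq_one hb₀v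
    have hπL : ((π : B) : L) ≠ 0 := fun e => hπ0 (Subtype.ext e)
    have e : ((x : B) : L) / u₀ = ((b * (↑v₀⁻¹ : B) : B) : L) := by
      rw [hxL, hu₀L, Subring.coe_mul, mul_div_mul_right _ _ hπL, div_eq_iff hb₀0, mul_assoc, ← Subring.coe_mul,
        ← hv₀, Units.inv_mul, Subring.coe_one, mul_one]
    show ((x : B) : L) / u₀ ∈ (B : Set L)
    rw [e]
    exact (b * (↑v₀⁻¹ : B) : B).2
  have hcl : Subring.closure ((B : Set L) ∪ (fun x : B => (x : L) / u₀) '' ↑u) = B :=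
    le_antisymm (Subring.closure_le.mpr (Set.union_subset (fun _ h => h) himg))
      (fun x hx => Subring.subset_closure (Or.inl hx))
  rw [hcl, hfix]

/-! ## 2. The start and the end of the towers along `ord_𝔪` -/

namespace OrdWitness

variable (p : ℕ) [hp : Fact p.Prime]

/-- **Roadmap T0: the tower starts at the image of `S`**: `locAtCentre (range (S → K)) O = range (S → K)` — the image is local and
dominated by `O` (an element of value `1` comes from outside `𝔪_S`, hence from a unit). [folklore] -/
theorem locAtCentre_range_eq :
    locAtCentre (algebraMap (S p) (K p)).range (O p) = (algebraMap (S p) (K p)).range := by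
  apply locAtCentre_eq_self_of_isUnit
  rintro ⟨_, s, rfl⟩ hv
  have hs : IsUnit s := by
    by_contra hns
    have hsm : s ∈ maximalIdeal (S p) := (IsLocalRing.mem_maximalIdeal _).mpr hns
    have := dominates p s hsm
    rw [hv] at this
    exact lt_irrefl _ this
  obtain ⟨w, hw⟩ := hs
  rw [isUnit_iff_exists_inv]
  have hinv : algebraMap (S p) (K p) s * algebraMap (S p) (K p) (↑w⁻¹ : S p) = 1 := by
    rw [← map_mul, ← hw, Units.mul_inv, map_one]
  exact ⟨⟨algebraMap (S p) (K p) (↑w⁻¹ : S p), (↑w⁻¹ : S p), rfl⟩, Subtype.ext hinv⟩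

/-- The image of `X₀` in `K` lies in `O` with value `exp (−1)`. [folklore] -/
theorem ordVK_X0 : ordVK p (algebraMap (Poly p) (K p) (X 0)) = expNeg 1 := by
  rw [ordVK_algebraMap]
  apply ordV_eq_expNeg p (X_ne_zero _)
  change WeightedBlowup.monomialOrd _ _ = _
  rw [WeightedBlowup.monomialOrd_X]

/-- **Roadmap T5-III (a): a regular parameter of `O = ord_𝔪` has order exactly `1`.**  For a member `B = O` of a tower: if
`t ∈ 𝔪_B ∖ 𝔪_B²` then `ordVK t = exp (−1)` — `ord t ≥ 2` would give `t = (t/X₀²)·X₀·X₀ ∈ 𝔪²`. [folklore] -/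
theorem ordVK_eq_expNeg_one_of_kindO (B : Subring (K p)) (hB : B = (O p).toSubring) [IsLocalRing B] (t : B)
    (ht : t ∈ maximalIdeal B) (ht2 : t ∉ maximalIdeal B ^ 2) : ordVK p (t : K p) = expNeg 1 := by
  subst hB
  have hfix : locAtCentre (O p).toSubring (O p) = (O p).toSubring :=
    le_antisymm (locAtCentre_le le_rfl) (le_locAtCentre _ _)
  have hdom : ∀ x : (O p).toSubring, x ∈ maximalIdeal (O p).toSubring ↔ ordVK p (x : K p) < 1 := fun x => by
    rw [mem_maximalIdeal_iff_valuation_lt_one le_rfl hfix x, valuation_O_lt_one_iff]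
  have hlt : ordVK p (t : K p) < 1 := (hdom t).mp ht
  have ht0 : (t : K p) ≠ 0 := by
    intro e
    apply ht2
    have : t = 0 := Subtype.ext e
    rw [this]; exact zero_mem _
  -- `X₀ ∈ 𝔪_O`
  set x0 : K p := algebraMap (Poly p) (K p) (X 0) with hx0
  have hx0v : ordVK p x0 = expNeg 1 := ordVK_X0 p
  have hx0O : x0 ∈ (O p).toSubring := by
    change x0 ∈ O p
    rw [mem_O_iff, hx0v]; exact expNeg_le_one 1
  have hx0m : (⟨x0, hx0O⟩ : (O p).toSubring) ∈ maximalIdeal (O p).toSubring := by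
    rw [hdom]; change ordVK p x0 < 1
    rw [hx0v, expNeg_lt_one_iff]; exact one_pos
  have hx00 : x0 ≠ 0 := by
    intro e; have := hx0v; rw [e, map_zero] at this; exact (expNeg_ne_zero 1) this.symm
  -- if `ord t ≥ 2` then `t ∈ 𝔪²`
  have hnot2 : ¬ ordVK p (t : K p) ≤ expNeg 2 := by
    intro hle
    apply ht2
    have hq : (t : K p) / (x0 * x0) ∈ (O p).toSubring := by
      change (t : K p) / (x0 * x0) ∈ O p
      rw [mem_O_iff, map_div₀, map_mul, hx0v, ← expNeg_add]
      rw [div_le_one₀ (pos_iff_ne_zero.mpr (expNeg_ne_zero _))]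
      exact hle
    have e : t = ⟨(t : K p) / (x0 * x0), hq⟩ * ⟨x0, hx0O⟩ * ⟨x0, hx0O⟩ := by
      apply Subtype.ext
      show (t : K p) = (t : K p) / (x0 * x0) * x0 * x0
      rw [mul_assoc, div_mul_cancel₀ _ (mul_ne_zero hx00 hx00)]
    rw [e, pow_two]
    exact Ideal.mul_mem_mul (Ideal.mul_mem_left _ _ hx0m) hx0m
  -- discreteness: `exp (−2) < ordVK t < 1` forces `ordVK t = exp (−1)`
  have hv0 : ordVK p (t : K p) ≠ 0 := (Valuation.ne_zero_iff _).mpr ht0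
  obtain ⟨z, hz⟩ := WithZero.ne_zero_iff_exists.mp hv0
  rw [← hz] at hlt hnot2 ⊢
  rw [expNeg, WithZero.coe_le_coe, not_le, ← Multiplicative.toAdd_lt, toAdd_ofAdd] at hnot2
  rw [← WithZero.coe_one, WithZero.coe_lt_coe, ← Multiplicative.toAdd_lt, toAdd_one] at hlt
  rw [expNeg, WithZero.coe_inj]
  have h2 : -(2 : ℤ) < Multiplicative.toAdd z := by simpa using hnot2
  have h3 : Multiplicative.toAdd z = -((1 : ℕ) : ℤ) := by push_cast; omega
  rw [← h3, ofAdd_toAdd]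

/-- **Roadmap T5-III (b): for a member equal to `O`, residues need no descent** (`e := d`). [folklore] -/
theorem exists_pow_of_kindO (B : Subring (K p)) (hB : B = (O p).toSubring) (u : B) (d : K p) (hd : d ∈ O p)
    (h : ordVK p ((u : K p) - d ^ p) < 1) : ∃ e : B, ordVK p ((u : K p) - (e : K p) ^ p) < 1 := by
  subst hB
  exact ⟨⟨d, hd⟩, h⟩

end OrdWitness

end Summit.ResolutionOfSingularities.ResolutionOfSingularities.Theorems.CleanModels.Negative

end
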